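import Summits.Ventures.PercRepro.Night2LocalRuleHybrid
import Summits.Ventures.PercRepro.Night2LocalLossFairCount

/-!
# PercRepro — the MISSED-POINT shares of the hybrid rule (night-2, gen 25)

A second concrete share function for `localShadowHall_of_hybrid`: the loss of a `P`-pair `(B, z)` at its covering
set `Q = B ∪ {z}` is split equally over the **missed-point targets** `Q ∪ {x}`, `x` ranging over the OTHER points of
`G ∖ cl B` (the points missed by `B` besides `z`).  A thin member misses at least two points of `G`, so every pair
has `|G ∖ cl B| − 1 ≥ 1` targets and the rows always sum to the loss — no residual-capacity condition enters the
definition (contrast `dOneTargets`, which needs `cap2 > 0` and a point outside the faces' common closure).  In the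
`(7, 5)` cell `(3, 2)` the targets `B ∪ {z, x}` of a big pair have at most one thin covering preimage and keep
`cap2 ≥ 11/60` (`Night2ThreeTwoMissedCap`).

* `missedTargets M G B z` — the sets `B ∪ {z, x}`, `x ∈ (G ∖ cl B) ∖ {z}`; `dshMissed` — the equal split of the loss;
* `mem_missedTargets`, `missedTargets_subset_shadowAt`, `card_missedTargets` (`= |G ∖ cl B| − 1`);
* `dshMissed_nonneg`, `dshMissed_supp`, `dshMissed_row` (the shares of a thin pair sum to its loss);
* **`localShadowHall_of_missed`**: `localShadowHall_of_hybrid` with `dsh := dshMissed` — (LI_G) from (i) the column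
  bound `dload S ≤ cap2 S` at every shadow set and (ii) the fair-share inequality of the non-`P` losses with `cap3`.
-/

namespace PercRepro.Shadow

open Finset PerFlat ThmH

variable {α : Type*} [DecidableEq α] {M : Matroid α} [M.Finite]

section Missed

variable (M) (q : ℕ) (G : Finset α)

/-- The missed-point targets of the pair `(B, z)`: the sets `B ∪ {z, x}` for the other points `x ∈ G ∖ cl B`. -/
noncomputable def missedTargets (B : Finset α) (z : α) : Finset (Finset α) :=
  ((G \ clF M B).erase z).image (fun x => insert x (insert z B))

/-- The equal split of the loss of `(B, z)` over its missed-point targets. -/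
noncomputable def dshMissed (B : Finset α) (z : α) (S : Finset α) : ℚ :=
  if S ∈ missedTargets M G B z then loss M q G B z / ((missedTargets M G B z).card : ℚ) else 0

end Missed

section MissedLemmas

variable {q : ℕ} {G : Finset α}

/-- Membership in `missedTargets`. -/
theorem mem_missedTargets {B S : Finset α} {z : α} :
    S ∈ missedTargets M G B z ↔ ∃ x ∈ G \ clF M B, x ≠ z ∧ insert x (insert z B) = S := by
  unfold missedTargets
  rw [Finset.mem_image]
  constructor
  · rintro ⟨x, hx, rfl⟩
    rw [Finset.mem_erase] at hx
    exact ⟨x, hx.2, hx.1, rfl⟩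
  · rintro ⟨x, hx, hne, rfl⟩
    exact ⟨x, Finset.mem_erase.2 ⟨hne, hx⟩, rfl⟩

omit [M.Finite] in
/-- A point of `G ∖ cl B` is not in `B`. -/
theorem notMem_of_mem_sdiff_clF' [M.Finite] {B : Finset α} {x : α} (hBg : B ⊆ gr M) (hx : x ∈ G \ clF M B) :
    x ∉ B := fun hxB => (Finset.mem_sdiff.1 hx).2 (subset_clF_of_subset_gr hBg hxB)

/-- The missed-point targets of a pair of a member inside `G` are shadow sets. -/
theorem missedTargets_subset_shadowAt (hG : G ∈ flatsQ M (q + 1)) {B : Finset α}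
    (hB : B ∈ membersIn M (Uq M (q + 2) q) G) {z : α} (hz : z ∈ G \ clF M B) :
    missedTargets M G B z ⊆ shadowAt M (q + 2) q (Uq M (q + 2) q) G := by
  intro S hS
  obtain ⟨x, hx, -, rfl⟩ := mem_missedTargets.1 hS
  have hBG : clF M B ⊆ G := (mem_membersIn.1 hB).2
  have hBU : B ∈ Uq M (q + 2) q := (mem_membersIn.1 hB).1
  have hBsub : B ⊆ G := (subset_clF hBU).trans hBG
  exact superset_mem_shadowAt hG hB hz (Finset.subset_insert x _)
    (Finset.insert_subset (Finset.mem_sdiff.1 hx).1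
      (Finset.insert_subset (Finset.mem_sdiff.1 hz).1 hBsub))

/-- `#missedTargets B z = |G ∖ cl B| − 1`. -/
theorem card_missedTargets {B : Finset α} (hBg : B ⊆ gr M) {z : α} (hz : z ∈ G \ clF M B) :
    (missedTargets M G B z).card = (G \ clF M B).card - 1 := by
  unfold missedTargets
  rw [Finset.card_image_of_injOn, Finset.card_erase_of_mem hz]
  intro x hx y hy hxy
  rw [Finset.mem_coe, Finset.mem_erase] at hx hy
  dsimp only at hxy
  have hxB : x ∉ insert z B := by
    rw [Finset.mem_insert, not_or]
    exact ⟨hx.1, notMem_of_mem_sdiff_clF' hBg hx.2⟩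
  have hyB : y ∉ insert z B := by
    rw [Finset.mem_insert, not_or]
    exact ⟨hy.1, notMem_of_mem_sdiff_clF' hBg hy.2⟩
  have h1 : x ∈ insert y (insert z B) := by
    rw [← hxy]; exact Finset.mem_insert_self x _
  rw [Finset.mem_insert] at h1
  rcases h1 with h1 | h1
  · exact h1
  · exact absurd h1 hxB

/-- A thin pair has at least one missed-point target. -/
theorem missedTargets_nonempty (hG : G ∈ flatsQ M (q + 1)) (hd : (gr M \ G).card ≤ q) {B : Finset α}
    (hB : B ∈ thinMembers M q G) {z : α} (hz : z ∈ G \ clF M B) :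
    (missedTargets M G B z).Nonempty := by
  rw [← Finset.card_pos, card_missedTargets (mem_Uq.1 (mem_membersIn.1 (mem_thinMembers.1 hB).1).1).1 hz]
  have := two_le_card_sdiff_of_not_lay0 hG hd (mem_thinMembers.1 hB).1 (mem_thinMembers.1 hB).2
  omega

/-- The missed-point shares are nonnegative. -/
theorem dshMissed_nonneg (hG : G ∈ flatsQ M (q + 1)) (hd : (gr M \ G).card ≤ q) (B : Finset α) (z : α)
    (S : Finset α) : 0 ≤ dshMissed M q G B z S := by
  unfold dshMissed
  split_ifs
  · exact div_nonneg (loss_nonneg' hG hd B z) (by positivity)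
  · exact le_refl _

/-- The missed-point shares are supported on the supersets of `B ∪ {z}`. -/
theorem dshMissed_supp (B : Finset α) (z : α) (S : Finset α) (h : dshMissed M q G B z S ≠ 0) :
    insert z B ⊆ S := by
  unfold dshMissed at h
  split_ifs at h with hS
  · obtain ⟨x, -, -, rfl⟩ := mem_missedTargets.1 hS
    exact Finset.subset_insert x _
  · exact absurd rfl h

open scoped Classical in
/-- The missed-point shares of a thin pair sum to its loss. -/
theorem dshMissed_row (hG : G ∈ flatsQ M (q + 1)) (hd : (gr M \ G).card ≤ q) {B : Finset α}
    (hB : B ∈ thinMembers M q G) {z : α} (hz : z ∈ G \ clF M B) :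
    ∑ S ∈ shadowAt M (q + 2) q (Uq M (q + 2) q) G, dshMissed M q G B z S = loss M q G B z := by
  unfold dshMissed
  rw [← Finset.sum_filter, Finset.filter_mem_eq_inter,
    Finset.inter_eq_right.2 (missedTargets_subset_shadowAt hG (mem_thinMembers.1 hB).1 hz),
    Finset.sum_const, nsmul_eq_mul]
  have hpos : (0 : ℚ) < ((missedTargets M G B z).card : ℚ) := by
    exact_mod_cast Finset.card_pos.2 (missedTargets_nonempty hG hd hB hz)
  field_simp

/-- The share received by a missed-point target is `loss/(|G ∖ cl B| − 1)`. -/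
theorem dshMissed_of_mem {B : Finset α} (hBg : B ⊆ gr M) {z : α} (hz : z ∈ G \ clF M B) {S : Finset α}
    (hS : S ∈ missedTargets M G B z) :
    dshMissed M q G B z S = loss M q G B z / (((G \ clF M B).card : ℚ) - 1) := by
  unfold dshMissed
  rw [if_pos hS, card_missedTargets hBg hz]
  have h1 : 1 ≤ (G \ clF M B).card := Finset.card_pos.2 ⟨z, hz⟩
  rw [Nat.cast_sub h1, Nat.cast_one]

open scoped Classical in
/-- **The local form from the hybrid rule with the missed-point shares**: (LI_G) follows from (i) the column bound
`dload S ≤ cap2 S` at every shadow set and (ii) the per-loss inequality of the non-`P` pairs with the capacities `cap3`. -/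
theorem localShadowHall_of_missed {P : Finset α → Prop} [DecidablePred P] (hG : G ∈ flatsQ M (q + 1))
    (hd : (gr M \ G).card ≤ q)
    (hdl : ∀ S ∈ shadowAt M (q + 2) q (Uq M (q + 2) q) G,
      dload M q G P (dshMissed M q G) S ≤ cap2 M q G S)
    (hcond : ∀ B ∈ thinMembers M q G, ¬ P B → ∀ z ∈ G \ clF M B,
      loss M q G B z ≤ rhoL M q G B z * lossIncomeH M q G P (dshMissed M q G) B z) :
    LocalShadowHall M q G :=
  localShadowHall_of_hybrid hG hd (dshMissed_nonneg hG hd) (dshMissed_supp)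
    (fun _ hB _ _ hz => dshMissed_row hG hd hB hz) hdl hcond

end MissedLemmas

end PercRepro.Shadow
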